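import Mathlib
import HarnessLib

/-!
# Route NewtonUnitEquations — crux `TwoProducts` (stmt-ValiantsHypothesis-5906), line `formal-log-linearisation`:
# the HYPERBOLIC-CROSS LEMMA for the lifted log-sum engine (theory lane on the OPEN stub 5 `stub_logSumEngine`)

Registered line `Cruxes/TwoProducts/Lines/formal-log-linearisation.lean` (NOT the item's skeleton of record; helper
mode `--supports stmt-ValiantsHypothesis-5906 --as helper`, no stub credit claimed).  Sequel to
`Theorems/NewtonUnitEquationsTwoProductsFormalLogLinearisationLiftedBox.lean` (BOX LEMMA), which it supersedes.

Context (memo `memo-logSumEngine-core.md`, evidence on the item): on a common support `E = {e_1,…,e_s}` of the tails,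
the coefficients of the log-sum `D` are fibre sums of the UNEQUAL-MOMENT FUNCTION `G(μ) = Σ_j A_j^μ − Σ_j B_j^μ` of the
two `m`-point configurations `A, B ⊂ ℂ^s`, and the line's OPEN engine needs (LIFTED PENCIL COUNT, necessary for it)
few `θ`-VISIBLE points `μ` — strict minimisers of a positive grading `θ` on `{G ≠ 0}`.  This file proves, over Mathlib
only and with `G` written inline (no definitions):

* `ExpSum.hyperbolicCross` — **HYPERBOLIC-CROSS LEMMA, general form.**  For a finite signed sum of monomial characters
  `F(ν) = Σ_{k ∈ κ} c_k ∏_i a_{ki}^{ν_i}` on `ℕ^s` and ANY real grading `θ`, a strict `θ`-minimiser `v` of `{F ≠ 0}`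
  (`F(v) ≠ 0`, and `F(ν) = 0` for every `ν ≠ v` with `⟨θ,ν⟩ ≤ ⟨θ,v⟩`) satisfies

    `∏_i (v_i + 1) ≤ |κ|`.

  Proof: the `∏ (v_i+1)` character columns `(a_k^β)_k`, `β ≤ v` componentwise, live in `ℂ^κ`; if they outnumber `|κ|`
  they satisfy a nontrivial relation `Σ_β g_β a_k^β = 0` (all `k`); shifting by `w = v − β*`, `β*` a `θ`-heaviest
  index in the support of `g`, gives `Σ_β g_β F(β + w) = 0`, where the `β*`-term is `g_{β*} F(v)` and every other
  term sits at a point `≠ v` of weight `≤ ⟨θ, v⟩`, hence vanishes — so `F(v) = 0`, contradiction.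
  (The BOX LEMMA `v_i + 1 ≤ |κ|` is the one-coordinate shadow of this.)
* `ExpSum.card_support_le_log` — hence `|supp v| ≤ log₂ |κ|`: a visible point involves at most `log₂ |κ|` coordinates
  (`2^{|supp v|} ≤ ∏ (v_i+1)`).
* `unequalMoment_hyperbolicCross`, `unequalMoment_pencilVisible_hyperbolicCross`,
  `unequalMoment_pencilVisible_card_support_le` — the engine's case `F = G` (`|κ| = 2m`), the last two in the verbatim
  pencil-visibility clause of the memo's `LiftedPencilCount` signature: pencil-visible unequal moments lie in the
  HYPERBOLIC CROSS `{μ : ∏ (μ_i+1) ≤ 2m}` and use at most `log₂(2m)` tail monomials.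

Consequences recorded in the memo (v2, evidence on the item; not formalised here): the lifted pencil count is
QUASI-POLYNOMIAL, `≤ #{μ ∈ ℕ^s : ∏(μ_i+1) ≤ 2m} ≤ 2m · s^{log₂ 2m}`, so the lifted statement holds outside the regime
`s ≥ 2^{Ω(m / log m)}`.  This RELOCATES the open content of the engine `stub_logSumEngine`: what remains open is FIBRE
CANCELLATION (planar coefficients are fibre sums `Σ_{π(μ)=λ} c_μ G(μ)`, which can vanish above a visible point although
`G ≠ 0` on the fibre — the shift argument below does not survive the push-forward) plus the lifted count in that extreme
regime.  Honest framing: an elementary structural lemma for the THEORY lane of an OPEN engine; `stub_logSumEngine` and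
the crux `TwoProducts` stay OPEN, the line is not the item's skeleton of record, and nothing here is progress on
`VP ≠ VNP` (NOT proved). No definitions, no named facts.
-/

noncomputable section

-- Sub = Summit single-conjunct layout: the duplicated namespace component is mandated by the tree.
set_option linter.dupNamespace false

namespace Summit.ValiantsHypothesis.ValiantsHypothesis.Theorems.NewtonUnitEquations.TwoProducts.FormalLogLinearisation

open scoped BigOperators

namespace ExpSum

variable {s : ℕ}

/-- The box below `v`: `{β : β ≤ v}` as a `piFinset`, of cardinality `∏ (v_i + 1)`. [folklore] -/
theorem card_boxBelow (v : Fin s → ℕ) :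
    (Fintype.piFinset fun i => Finset.range (v i + 1)).card = ∏ i, (v i + 1) := by
  rw [Fintype.card_piFinset]
  simp

/-- Membership in the box below `v` is `β ≤ v`. [folklore] -/
theorem mem_boxBelow {v β : Fin s → ℕ} :
    β ∈ (Fintype.piFinset fun i => Finset.range (v i + 1)) ↔ ∀ i, β i ≤ v i := by
  simp [Fintype.mem_piFinset]

/-- Shifting a monomial character: `a^{β + w} = a^w · a^β`. [folklore] -/
theorem prod_pow_add (a : Fin s → ℂ) (β w : Fin s → ℕ) :
    ∏ i, a i ^ (β i + w i) = (∏ i, a i ^ w i) * ∏ i, a i ^ β i := by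
  rw [← Finset.prod_mul_distrib]
  exact Finset.prod_congr rfl fun i _ => by ring

/-- **HYPERBOLIC-CROSS LEMMA (general signed exponential sum).**  Let `F(ν) = Σ_k c_k ∏_i a_{ki}^{ν_i}` (finite index
type `κ`) and let `θ` be any real grading.  If `F(v) ≠ 0` and `F(ν) = 0` for every `ν ≠ v` with `⟨θ,ν⟩ ≤ ⟨θ,v⟩`
(i.e. `v` is the STRICT `θ`-minimiser of `{F ≠ 0}`), then `∏_i (v_i + 1) ≤ |κ|`: the visible point lies in the
hyperbolic cross of the number of terms.  (Linear dependence of the `∏(v_i+1)` character columns below `v` in `ℂ^κ`,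
shifted so that its `θ`-heaviest term sits at `v`.) [folklore] -/
theorem hyperbolicCross {κ : Type*} [Fintype κ] (c : κ → ℂ) (a : κ → Fin s → ℂ) (θ : Fin s → ℝ)
    (v : Fin s → ℕ) (hv : ∑ k, c k * ∏ i, a k i ^ v i ≠ 0)
    (hmin : ∀ ν : Fin s → ℕ, ν ≠ v → ∑ i, θ i * (ν i : ℝ) ≤ ∑ i, θ i * (v i : ℝ) →
      ∑ k, c k * ∏ i, a k i ^ ν i = 0) :
    ∏ i, (v i + 1) ≤ Fintype.card κ := by
  classical
  by_contra hlt
  push Not at hlt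
  set D := Fintype.piFinset fun i => Finset.range (v i + 1) with hD
  -- the character columns below `v`, as vectors in `κ → ℂ`
  let col : (Fin s → ℕ) → (κ → ℂ) := fun β k => ∏ i, a k i ^ β i
  -- too many columns: they are linearly dependent
  have hdep : ¬ LinearIndependent ℂ (fun β : D => col β.1) := by
    intro hli
    have h1 := hli.fintype_card_le_finrank
    rw [Module.finrank_fintype_fun_eq_card, Fintype.card_coe, hD, card_boxBelow] at h1
    exact absurd h1 (not_le.mpr hlt)
  obtain ⟨g, hg0, ⟨β₀, hβ₀⟩⟩ := Fintype.not_linearIndependent_iff.mp hdep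
  -- a `θ`-heaviest index in the support of `g`
  obtain ⟨βs, hβs, hmax⟩ := Finset.exists_max_image (Finset.univ.filter fun β : D => g β ≠ 0)
    (fun β : D => ∑ i, θ i * ((β.1 i : ℕ) : ℝ)) ⟨β₀, Finset.mem_filter.mpr ⟨Finset.mem_univ _, hβ₀⟩⟩
  have hgβs : g βs ≠ 0 := (Finset.mem_filter.mp hβs).2
  have hβsle : ∀ i, βs.1 i ≤ v i := mem_boxBelow.mp βs.2
  -- the shift `w = v − βs` (componentwise, `βs ≤ v`)
  set w : Fin s → ℕ := fun i => v i - βs.1 i with hw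
  have hβsw : (fun i => βs.1 i + w i) = v := funext fun i => by
    have := hβsle i; simp only [hw]; omega
  -- the relation evaluated coordinatewise: `Σ_β g_β a_k^β = 0` for every `k`
  have hrel : ∀ k, ∑ β : D, g β * ∏ i, a k i ^ β.1 i = 0 := fun k => by
    have := congr_fun hg0 k
    simpa [col, Finset.sum_apply, Pi.smul_apply, smul_eq_mul] using this
  -- hence the shifted relation `Σ_β g_β F(β + w) = 0`
  have hshift : ∑ β : D, g β * ∑ k, c k * ∏ i, a k i ^ (β.1 i + w i) = 0 := by
    calc ∑ β : D, g β * ∑ k, c k * ∏ i, a k i ^ (β.1 i + w i)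
        = ∑ β : D, ∑ k, g β * (c k * ((∏ i, a k i ^ w i) * ∏ i, a k i ^ β.1 i)) := by
          refine Finset.sum_congr rfl fun β _ => ?_
          rw [Finset.mul_sum]
          exact Finset.sum_congr rfl fun k _ => by rw [prod_pow_add]
      _ = ∑ k, (c k * ∏ i, a k i ^ w i) * ∑ β : D, g β * ∏ i, a k i ^ β.1 i := by
          rw [Finset.sum_comm]
          refine Finset.sum_congr rfl fun k _ => ?_
          rw [Finset.mul_sum]
          exact Finset.sum_congr rfl fun β _ => by ring
      _ = 0 := Finset.sum_eq_zero fun k _ => by rw [hrel k, mul_zero]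
  -- all terms other than `β = βs` vanish: they sit at points `≠ v` of weight `≤ ⟨θ, v⟩`
  have hvan : ∀ β : D, β ≠ βs → g β * ∑ k, c k * ∏ i, a k i ^ (β.1 i + w i) = 0 := by
    intro β hne
    by_cases hgβ : g β = 0
    · rw [hgβ, zero_mul]
    have hle : ∑ i, θ i * ((β.1 i : ℕ) : ℝ) ≤ ∑ i, θ i * ((βs.1 i : ℕ) : ℝ) :=
      hmax β (Finset.mem_filter.mpr ⟨Finset.mem_univ _, hgβ⟩)
    have hne' : (fun i => β.1 i + w i) ≠ v := by
      intro h
      apply hne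
      apply Subtype.ext
      funext i
      have h1 : β.1 i + w i = v i := congr_fun h i
      have h2 : βs.1 i + w i = v i := congr_fun hβsw i
      omega
    have hwt : ∑ i, θ i * (((fun i => β.1 i + w i) i : ℕ) : ℝ) ≤ ∑ i, θ i * (v i : ℝ) := by
      have hv' : ∑ i, θ i * (v i : ℝ) = ∑ i, θ i * (((βs.1 i + w i : ℕ)) : ℝ) := by
        refine Finset.sum_congr rfl fun i _ => ?_
        rw [← congr_fun hβsw i]
      rw [hv']
      simp only [Nat.cast_add]
      have : ∑ i, θ i * ((β.1 i : ℝ) + (w i : ℝ)) = ∑ i, θ i * (β.1 i : ℝ) + ∑ i, θ i * (w i : ℝ) := by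
        rw [← Finset.sum_add_distrib]; exact Finset.sum_congr rfl fun i _ => by ring
      have : ∑ i, θ i * ((βs.1 i : ℝ) + (w i : ℝ)) = ∑ i, θ i * (βs.1 i : ℝ) + ∑ i, θ i * (w i : ℝ) := by
        rw [← Finset.sum_add_distrib]; exact Finset.sum_congr rfl fun i _ => by ring
      linarith
    rw [hmin _ hne' hwt, mul_zero]
  -- so the `βs`-term, `g βs · F(v)`, vanishes too
  rw [← Finset.sum_erase_add _ _ (Finset.mem_univ βs),
    Finset.sum_eq_zero (fun β hβ => hvan β (Finset.ne_of_mem_erase hβ)), zero_add] at hshift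
  have hFv : ∑ k, c k * ∏ i, a k i ^ (βs.1 i + w i) = ∑ k, c k * ∏ i, a k i ^ v i :=
    Finset.sum_congr rfl fun k _ => by
      refine congrArg _ (Finset.prod_congr rfl fun i _ => ?_)
      rw [← congr_fun hβsw i]
  rw [hFv] at hshift
  exact hv ((mul_eq_zero.mp hshift).resolve_left hgβs)

/-- **Support bound.**  Under the hypotheses of `hyperbolicCross`, the visible point uses at most `log₂ |κ|`
coordinates: `2 ^ |supp v| ≤ ∏ (v_i + 1) ≤ |κ|`. [folklore] -/
theorem card_support_le_log {κ : Type*} [Fintype κ] (c : κ → ℂ) (a : κ → Fin s → ℂ) (θ : Fin s → ℝ)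
    (v : Fin s → ℕ) (hv : ∑ k, c k * ∏ i, a k i ^ v i ≠ 0)
    (hmin : ∀ ν : Fin s → ℕ, ν ≠ v → ∑ i, θ i * (ν i : ℝ) ≤ ∑ i, θ i * (v i : ℝ) →
      ∑ k, c k * ∏ i, a k i ^ ν i = 0) :
    (Finset.univ.filter fun i => v i ≠ 0).card ≤ Nat.log 2 (Fintype.card κ) := by
  classical
  have hcross := hyperbolicCross c a θ v hv hmin
  have hpow : 2 ^ (Finset.univ.filter fun i => v i ≠ 0).card ≤ ∏ i, (v i + 1) := by
    calc 2 ^ (Finset.univ.filter fun i => v i ≠ 0).card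
        = ∏ i ∈ Finset.univ.filter (fun i => v i ≠ 0), 2 := by simp
      _ ≤ ∏ i ∈ Finset.univ.filter (fun i => v i ≠ 0), (v i + 1) := by
          refine Finset.prod_le_prod' fun i hi => ?_
          have := (Finset.mem_filter.mp hi).2
          omega
      _ ≤ ∏ i, (v i + 1) :=
          Finset.prod_le_prod_of_subset_of_one_le' (Finset.filter_subset _ _) fun i _ _ => Nat.succ_pos _
  exact Nat.le_log_of_pow_le (by norm_num) (hpow.trans hcross)

end ExpSum

/-- **Hyperbolic cross for unequal moments.**  For two `m`-point configurations `A, B` in `ℂ^s` and any real grading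
`θ`, a strict `θ`-minimiser `μ` of `{G ≠ 0}`, `G(ν) = Σ_j A_j^ν − Σ_j B_j^ν`, satisfies `∏_i (μ_i + 1) ≤ 2m`
(`ExpSum.hyperbolicCross` with the `2m` signed terms `+A_j`, `−B_j`). [folklore] -/
theorem unequalMoment_hyperbolicCross {m s : ℕ} (A B : Fin m → Fin s → ℂ) (θ : Fin s → ℝ) (μ : Fin s → ℕ)
    (hμ : (∑ j, ∏ i, A j i ^ μ i) ≠ (∑ j, ∏ i, B j i ^ μ i))
    (hmin : ∀ ν : Fin s → ℕ, ν ≠ μ → ∑ i, θ i * (ν i : ℝ) ≤ ∑ i, θ i * (μ i : ℝ) →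
      (∑ j, ∏ i, A j i ^ ν i) = (∑ j, ∏ i, B j i ^ ν i)) :
    ∏ i, (μ i + 1) ≤ 2 * m := by
  classical
  let c : Fin m ⊕ Fin m → ℂ := Sum.elim (fun _ => 1) (fun _ => -1)
  let a : Fin m ⊕ Fin m → Fin s → ℂ := Sum.elim A B
  have hF : ∀ ν : Fin s → ℕ, ∑ k, c k * ∏ i, a k i ^ ν i =
      (∑ j, ∏ i, A j i ^ ν i) - (∑ j, ∏ i, B j i ^ ν i) := fun ν => by
    rw [Fintype.sum_sum_type]
    simp only [c, a, Sum.elim_inl, Sum.elim_inr, one_mul, neg_mul, Finset.sum_neg_distrib]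
    ring
  have hμ' : ∑ k, c k * ∏ i, a k i ^ μ i ≠ 0 := by rw [hF]; exact sub_ne_zero.mpr hμ
  have hmin' : ∀ ν : Fin s → ℕ, ν ≠ μ → ∑ i, θ i * (ν i : ℝ) ≤ ∑ i, θ i * (μ i : ℝ) →
      ∑ k, c k * ∏ i, a k i ^ ν i = 0 := fun ν hne hν => by
    rw [hF]; exact sub_eq_zero.mpr (hmin ν hne hν)
  have h := ExpSum.hyperbolicCross c a θ μ hμ' hmin'
  simp only [Fintype.card_sum, Fintype.card_fin] at h
  omega

/-- **Hyperbolic cross under the pencil-visibility clause** of the memo's `LiftedPencilCount` (verbatim hypothesis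
shape): a pencil-visible unequal moment `μ` of two `m`-point configurations satisfies `∏_i (μ_i + 1) ≤ 2m`.  Hence the
pencil-visible set lies in the finite hyperbolic cross `{μ : ∏ (μ_i+1) ≤ 2m}` — a quasi-polynomial bound
`≤ 2m · s^{log₂ 2m}` on the lifted pencil count (memo v2). [folklore] -/
theorem unequalMoment_pencilVisible_hyperbolicCross {m s : ℕ} (A B : Fin m → Fin s → ℂ) (θ₁ θ₂ : Fin s → ℝ)
    (μ : Fin s → ℕ)
    (hvis : (∑ j, ∏ i, A j i ^ μ i) ≠ (∑ j, ∏ i, B j i ^ μ i) ∧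
      ∃ c : ℝ, 0 < c ∧ ∀ ν : Fin s → ℕ, ν ≠ μ →
        (∑ j, ∏ i, A j i ^ ν i) ≠ (∑ j, ∏ i, B j i ^ ν i) →
          ∑ i, (θ₁ i + c * θ₂ i) * (μ i : ℝ) < ∑ i, (θ₁ i + c * θ₂ i) * (ν i : ℝ)) :
    ∏ i, (μ i + 1) ≤ 2 * m := by
  obtain ⟨hμ, c, -, hstrict⟩ := hvis
  refine unequalMoment_hyperbolicCross A B (fun i => θ₁ i + c * θ₂ i) μ hμ fun ν hne hle => ?_
  by_contra hG
  exact absurd (hstrict ν hne hG) (not_lt.mpr hle)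

/-- **Support bound under the pencil-visibility clause**: a pencil-visible unequal moment of two `m`-point
configurations involves at most `log₂(2m)` coordinates (tail monomials). [folklore] -/
theorem unequalMoment_pencilVisible_card_support_le {m s : ℕ} (A B : Fin m → Fin s → ℂ) (θ₁ θ₂ : Fin s → ℝ)
    (μ : Fin s → ℕ)
    (hvis : (∑ j, ∏ i, A j i ^ μ i) ≠ (∑ j, ∏ i, B j i ^ μ i) ∧
      ∃ c : ℝ, 0 < c ∧ ∀ ν : Fin s → ℕ, ν ≠ μ →
        (∑ j, ∏ i, A j i ^ ν i) ≠ (∑ j, ∏ i, B j i ^ ν i) →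
          ∑ i, (θ₁ i + c * θ₂ i) * (μ i : ℝ) < ∑ i, (θ₁ i + c * θ₂ i) * (ν i : ℝ)) :
    (Finset.univ.filter fun i => μ i ≠ 0).card ≤ Nat.log 2 (2 * m) := by
  classical
  have hcross := unequalMoment_pencilVisible_hyperbolicCross A B θ₁ θ₂ μ hvis
  have hpow : 2 ^ (Finset.univ.filter fun i => μ i ≠ 0).card ≤ ∏ i, (μ i + 1) := by
    calc 2 ^ (Finset.univ.filter fun i => μ i ≠ 0).card
        = ∏ i ∈ Finset.univ.filter (fun i => μ i ≠ 0), 2 := by simp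
      _ ≤ ∏ i ∈ Finset.univ.filter (fun i => μ i ≠ 0), (μ i + 1) := by
          refine Finset.prod_le_prod' fun i hi => ?_
          have := (Finset.mem_filter.mp hi).2
          omega
      _ ≤ ∏ i, (μ i + 1) :=
          Finset.prod_le_prod_of_subset_of_one_le' (Finset.filter_subset _ _) fun i _ _ => Nat.succ_pos _
  exact Nat.le_log_of_pow_le (by norm_num) (hpow.trans hcross)

end Summit.ValiantsHypothesis.ValiantsHypothesis.Theorems.NewtonUnitEquations.TwoProducts.FormalLogLinearisation

end
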